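import Summits.ResolutionOfSingularities.ResolutionOfSingularities.Theorems.HilbertSamuelEliminationSigmaMaxModificationsCorridor3CodimOnePoints
import Summits.ResolutionOfSingularities.ResolutionOfSingularities.Theorems.HilbertSamuelEliminationSigmaMaxModificationsCorridor3StratumRound
import Summits.ResolutionOfSingularities.ResolutionOfSingularities.Theorems.HilbertSamuelEliminationSigmaMaxModificationsStubCentreSeqPackage
import Literature.AlgebraicGeometry.Resolution.OneDimensionalBlowupTower
import Literature.AlgebraicGeometry.Resolution.NuEliminationInDim
import HarnessLib

/-!
# Route `HilbertSamuelElimination`, crux `SigmaMaxModificationsCorridor3`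
# (stmt-ResolutionOfSingularities-19249; child of `SigmaMaxModifications` stmt-…-18506),
# line `tame_wild` v3 — RUNG FC-R1: the maximal stratum is killed over the codimension-one points

[OURS · L1 W4.2] The rung FC-R1 of card `fibral-confinement` (CHAIN w42 §4, row stub-3) = the first
round type of the confinement stub `stub_confine3` of skeleton v3, assembled from the landed bricks
(p478970 regular centres permissible, p479795 stratum push-forward, p482115 one round, p484342
quadratic-transform fibre, p485430 codimension-one points) MODULO the two printed theorems it rests
on, both named facts of the tree taken as hypotheses: Cossart–Jannsen–Saito 2020 Thm. 1.2 with
permissible centres (`CossartJannsenSaito2020SequencePermissible`) and Krull 1930 / Kollár 2007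
Thm. 1.101 (`Kollar2007_thm_1_101_localChain`).

NOT a statement of any manuscript; AI-written, weaker than expert review.

## Sources

* V. Cossart, U. Jannsen, S. Saito, LNM 2270 (2020), Thm. 1.2, Def. 3.1, Thm. 3.3, Thm. 3.10 (1),
  Lemma 3.15 (1), Def. 6.14, Rem. 6.29 (1). [CossartJannsenSaito2020]
* J. Kollár, *Lectures on Resolution of Singularities* (2007), 3.30.3, Thm. 1.101. [Kollar2007]
* The Stacks Project, Tags 01J7, 02OS, 0BA8. [StacksProject]
-/

set_option linter.dupNamespace false -- mandated namespace of this single-conjunct summit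

noncomputable section

open CategoryTheory CategoryTheory.Limits AlgebraicGeometry TopologicalSpace Topology IsLocalRing
open Literature.AlgebraicGeometry.Resolution Literature.RingTheory.HilbertSamuel
open Summit.ResolutionOfSingularities.ResolutionOfSingularities.Theorems.SigmaMaxModifications.Sketch

namespace Summit.ResolutionOfSingularities.ResolutionOfSingularities.Theorems.SigmaMaxModificationsCorridor3.Helpers

universe u

/-! ## Bookkeeping along a blow-up sequence -/

/-- Blowing up does not raise the dimension of local rings, along a whole sequence:
`dim 𝒪_{X_r,y} ≤ dim 𝒪_{X, comp y}`. [cite: GortzWedhorn2020, Prop. 13.91] -/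
theorem CentreSeq.ringKrullDim_stalk_le_comp :
    ∀ {X : Scheme.{u}} [IsLocallyNoetherian X] (s : CentreSeq X) (y : s.top),
      ringKrullDim (s.top.presheaf.stalk y) ≤ ringKrullDim (X.presheaf.stalk (s.comp.base y))
  | _, _, CentreSeq.nil _, _ => le_rfl
  | X, _, CentreSeq.cons C rest, y => by
    haveI : IsProper (blowup.π C) := (blowup.isBlowup C).isProper
    haveI : IsLocallyNoetherian (blowup C) := LocallyOfFiniteType.isLocallyNoetherian (blowup.π C)
    have h1 := CentreSeq.ringKrullDim_stalk_le_comp rest y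
    have h2 := (blowup.isBlowup C).ringKrullDim_stalk_le_of_isLocallyNoetherian (rest.comp.base y)
    show ringKrullDim (rest.top.presheaf.stalk y) ≤
      ringKrullDim (X.presheaf.stalk ((rest.comp ≫ blowup.π C).base y))
    rw [Scheme.Hom.comp_apply]
    exact h1.trans h2

/-- The maximal points of a closed subset of a Noetherian scheme are finitely many (Stacks 0BA8:
finitely many per affine open, `finite_maxPoints_inter_of_isAffineOpen`, and finitely many affine
opens cover). [cite: StacksProject, Tag 0BA8] -/
theorem finite_maxPoints_of_isNoetherian {X : Scheme.{u}} [IsNoetherian X] {Z : Set X}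
    (hZ : IsClosed Z) : (maxPoints Z).Finite := by
  -- a finite affine open cover
  have hcov : (Set.univ : Set X) ⊆ ⋃ U : X.affineOpens, (U : Set X) := fun x _ => by
    obtain ⟨U, hU, hxU, -⟩ :=
      exists_isAffineOpen_mem_and_subset (X := X) (x := x) (U := ⊤) (Opens.mem_top x)
    exact Set.mem_iUnion.mpr ⟨⟨U, hU⟩, hxU⟩
  obtain ⟨t, ht⟩ := isCompact_univ.elim_finite_subcover (fun U : X.affineOpens => (U : Set X))
    (fun U => U.1.isOpen) hcov
  have hsub : maxPoints Z ⊆ ⋃ U ∈ t, (maxPoints Z ∩ (U : Set X)) := by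
    intro x hx
    have hx' := ht (Set.mem_univ x)
    simp only [Set.mem_iUnion] at hx' ⊢
    obtain ⟨U, hU, hxU⟩ := hx'
    exact ⟨U, hU, hx, hxU⟩
  exact Set.Finite.subset (Set.Finite.biUnion t.finite_toSet fun U _ =>
    finite_maxPoints_inter_of_isAffineOpen U.2 hZ) hsub

/-- `x < n + 1 ⇒ x ≤ n` in `WithBot ℕ∞`. [folklore] -/
theorem withBotENat_le_of_lt_succ {x : WithBot ℕ∞} {n : ℕ} (h : x < ((n + 1 : ℕ) : WithBot ℕ∞)) :
    x ≤ (n : WithBot ℕ∞) := by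
  induction x using WithBot.recBotCoe with
  | bot => exact bot_le
  | coe a =>
    induction a using ENat.recTopCoe with
    | top => exact absurd h (by simp)
    | coe b =>
      have : b < n + 1 := by exact_mod_cast h
      exact_mod_cast Nat.lt_succ_iff.mp this

/-- **The stratum of a value with nothing above it is closed**, on a Noetherian scheme locally of
finite type over a field: `Y(ν) = Y(≥ ν)` is closed by upper semicontinuity (CJS Thm. 2.33, sharp
form over a field). [cite: CossartJannsenSaito2020, Thm. 2.33, Lemma 2.36] -/
theorem isClosed_hsStratum_of_forall_le {k : Type u} [Field k] {Y : Scheme.{u}} (g : Y ⟶ Spec (.of k))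
    [LocallyOfFiniteType g] [IsNoetherian Y] {N : ℕ} (hdim : topologicalKrullDim Y ≤ (N : WithBot ℕ∞))
    {ν : ℕ → ℕ} (hup : ∀ μ ∈ Scheme.hsValues Y N, ν ≤ μ → μ ≤ ν) :
    IsClosed (Scheme.hsStratum Y N ν) := by
  have hexc : Scheme.IsExcellent Y :=
    Scheme.isExcellent_of_locallyOfFiniteType Stacks07QW_field_holds g
  have heq : Scheme.hsStratum Y N ν = Scheme.hsStratumGE Y N ν := by
    ext y
    simp only [Scheme.mem_hsStratum_iff, Scheme.mem_hsStratumGE_iff]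
    exact ⟨fun h => h ▸ le_rfl, fun h => le_antisymm (hup _ ⟨y, rfl⟩ h) h⟩
  rw [heq]
  exact Scheme.isClosed_hsStratumGE_of_isExcellent hexc N
    (Scheme.hsPsi_le_of_topologicalKrullDim_le hdim)
    (fun x y h => Scheme.hsFun_le_hsFun_of_specializes_over_field g N h) ν

/-- A point of a stratum `ν ≠ Φ^{(N)}` with `dim 𝒪 ≤ N` is not a regular point.
[cite: CossartJannsenSaito2020, Lemma 2.31] -/
theorem not_isRegularLocalRing_of_mem_hsStratum {Y : Scheme.{u}} [IsLocallyNoetherian Y] {N : ℕ}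
    {ν : ℕ → ℕ} (hν : ν ≠ iterPSum N Phi) {y : Y} (hy : y ∈ Scheme.hsStratum Y N ν)
    (hdim : ringKrullDim (Y.presheaf.stalk y) ≤ N) : ¬ IsRegularLocalRing (Y.presheaf.stalk y) :=
  fun hreg => hν ((Scheme.mem_hsStratum_iff.mp hy).symm.trans
    ((Scheme.hsFun_eq_iterPSum_Phi_iff N y).mpr ⟨hreg, hdim⟩))

/-- Transport of a point of the last scheme of a concatenation `s ⧺ t` to the last scheme of `t`
(`CentreSeq.top_append`): same image in the base, same Hilbert–Samuel function, isomorphic local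
ring. [folklore] -/
theorem CentreSeq.transport_append {X : Scheme.{u}} (s : CentreSeq X) (t : CentreSeq s.top) (N : ℕ)
    (z : (s.append t).top) :
    ∃ zt : t.top, (s.append t).comp.base z = s.comp.base (t.comp.base zt) ∧
      Scheme.hsFun (s.append t).top N z = Scheme.hsFun t.top N zt ∧
      Nonempty ((s.append t).top.presheaf.stalk z ≅ t.top.presheaf.stalk zt) := by
  refine ⟨(eqToHom (CentreSeq.top_append s t)).base z, ?_, ?_, ⟨?_⟩⟩
  · rw [CentreSeq.comp_append, Scheme.Hom.comp_apply, Scheme.Hom.comp_apply]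
  · exact (Scheme.hsFun_eqToHom_base (CentreSeq.top_append s t) N z).symm
  · exact (asIso ((eqToHom (CentreSeq.top_append s t)).stalkMap z)).symm

/-! ## The iteration -/

/-- **FC-R1, iterated rounds with the chain invariant.** After `n` confinement rounds (each:
CJS-resolve the reduced closure of the codimension-one `ν`-points lying over codimension-one points
of `Y`, push forward, blow up the regular image — `exists_centreSeq_round`), the composite blow-up
sequence has regular centres in the successive `ν`-strata, and every point of the last `ν`-stratum
lying over a codimension-one point `η` of `Y` carries a chain of `n` successive LOCAL QUADRATIC
TRANSFORMS from `𝒪_{Y,η}` to its own local ring, all of them non-regular. Modulo CJS Thm. 1.2 with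
permissible centres (`hCJS`). [cite: CossartJannsenSaito2020, Thm. 1.2, Rem. 6.29 (1)]
[cite: Kollar2007, 3.30.3] -/
theorem fcR1_iterate (hCJS : CossartJannsenSaito2020SequencePermissible.{u}) {k : Type u} [Field k]
    {ν : ℕ → ℕ} (hν : ν ≠ iterPSum 3 Phi) :
    ∀ (n : ℕ) {Y : Scheme.{u}} (g : Y ⟶ Spec (.of k)) [LocallyOfFiniteType g] [QuasiCompact g]
      [IsReduced Y], topologicalKrullDim Y ≤ ((3 : ℕ) : WithBot ℕ∞) →
      (∀ μ ∈ Scheme.hsValues Y 3, ν ≤ μ → μ ≤ ν) →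
      ∃ s : CentreSeq Y, s.AllRegular ∧ s.CentresInStratum 3 ν ∧
        ∀ y' : s.top, y' ∈ Scheme.hsStratum s.top 3 ν →
          ringKrullDim (Y.presheaf.stalk (s.comp.base y')) = 1 →
          ∃ R : ℕ → CommRingCat.{u},
            Nonempty (R 0 ≅ Y.presheaf.stalk (s.comp.base y')) ∧
            Nonempty (R n ≅ s.top.presheaf.stalk y') ∧
            (∀ i, i < n → ∃ (X X' : Scheme.{u}) (π : X' ⟶ X) (D : X.IdealSheafData) (x : X)
                (x' : X'), IsBlowup π D ∧ stalkIdeal D x = maximalIdeal (X.presheaf.stalk x) ∧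
                  π.base x' = x ∧ Nonempty (X.presheaf.stalk x ≅ R i) ∧
                  Nonempty (X'.presheaf.stalk x' ≅ R (i + 1))) ∧
            (∀ i, i ≤ n → ¬ IsRegularLocalRing (R i))
  | 0, Y, g, _, _, _, hdim, hup => by
    haveI : IsLocallyNoetherian Y := LocallyOfFiniteType.isLocallyNoetherian g
    refine ⟨CentreSeq.nil Y, trivial, trivial, fun y' hy' hη => ?_⟩
    have hy'' : (CentreSeq.nil Y).comp.base y' = y' := rfl
    refine ⟨fun _ => Y.presheaf.stalk y', ⟨eqToIso (by rw [hy''])⟩, ⟨Iso.refl _⟩,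
      fun i hi => absurd hi (Nat.not_lt_zero i), fun i _ => ?_⟩
    rw [hy''] at hη
    exact not_isRegularLocalRing_of_mem_hsStratum hν hy' (by rw [hη]; exact_mod_cast (by norm_num : (1:ℕ) ≤ 3))
  | n + 1, Y, g, _, _, _, hdim, hup => by
    haveI : IsLocallyNoetherian Y := LocallyOfFiniteType.isLocallyNoetherian g
    have hexc : Scheme.IsExcellent Y :=
      Scheme.isExcellent_of_locallyOfFiniteType Stacks07QW_field_holds g
    -- the first `n` rounds
    obtain ⟨s, hreg, hstr, hpts⟩ := fcR1_iterate hCJS hν n g hdim hup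
    -- the scheme `Y_n = s.top`
    haveI : IsProper s.comp := CentreSeq.isProper_comp s
    haveI : IsReduced s.top := isReduced_top s
    haveI : IsLocallyNoetherian s.top := LocallyOfFiniteType.isLocallyNoetherian (s.comp ≫ g)
    haveI : CompactSpace s.top := QuasiCompact.compactSpace_of_compactSpace (s.comp ≫ g)
    haveI : IsNoetherian s.top := {}
    have hexcn : Scheme.IsExcellent s.top :=
      Scheme.isExcellent_of_locallyOfFiniteType Stacks07QW_field_holds (s.comp ≫ g)
    have hdimn : topologicalKrullDim s.top ≤ ((3 : ℕ) : WithBot ℕ∞) := topologicalKrullDim_top_le s hdim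
    have hmonos : ∀ y : s.top, Scheme.hsFun s.top 3 y ≤ Scheme.hsFun Y 3 (s.comp.base y) :=
      CentreSeq.hsFun_comp_le_of_allRegular_of_centresInStratum s hexc hdim hν hreg hstr
    have hupn : ∀ μ ∈ Scheme.hsValues s.top 3, ν ≤ μ → μ ≤ ν := by
      rintro μ ⟨y, rfl⟩ hle
      exact (hmonos y).trans (hup _ ⟨s.comp.base y, rfl⟩ (hle.trans (hmonos y)))
    -- if `ν` is no longer a value, nothing is left to do
    by_cases hνval : ν ∈ Scheme.hsValues s.top 3
    swap
    · refine ⟨s, hreg, hstr, fun y' hy' _ => absurd ⟨y', Scheme.mem_hsStratum_iff.mp hy'⟩ hνval⟩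
    have hmaxn : Maximal (· ∈ Scheme.hsValues s.top 3) ν := ⟨hνval, fun μ hμ hle => hupn μ hμ hle⟩
    -- the surface of this round: the closure of the codimension-one `ν`-points over codimension one
    set B : Set s.top := {y | y ∈ Scheme.hsStratum s.top 3 ν ∧
      ringKrullDim (Y.presheaf.stalk (s.comp.base y)) = 1} with hB
    have hclosed : IsClosed (Scheme.hsStratum s.top 3 ν) :=
      isClosed_hsStratum_of_forall_le (s.comp ≫ g) hdimn hupn
    set Z : Closeds s.top := ⟨closure B, isClosed_closure⟩ with hZ
    have hZν : (Z : Set s.top) ⊆ Scheme.hsStratum s.top 3 ν :=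
      closure_minimal (fun y hy => hy.1) hclosed
    haveI : IsReduced (Scheme.IdealSheafData.vanishingIdeal Z).subscheme :=
      isReduced_subscheme_vanishingIdeal Z
    have hS2 : topologicalKrullDim (Scheme.IdealSheafData.vanishingIdeal Z).subscheme ≤
        ((2 : ℕ) : WithBot ℕ∞) :=
      withBotENat_le_of_lt_succ (topologicalKrullDim_subscheme_vanishingIdeal_lt hν Z hZν 3
        (hdimn.trans_lt (by exact_mod_cast Nat.lt_succ_self 3)))
    have hτ : Set.range (Scheme.IdealSheafData.vanishingIdeal Z).subschemeι.base ⊆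
        Scheme.hsStratum s.top 3 ν := by
      rw [range_subschemeι_vanishingIdeal]; exact hZν
    -- ONE ROUND (p482115)
    obtain ⟨s₁, D, hreg₁, hstr₁, hDreg, hDν, hround⟩ := exists_centreSeq_round hCJS (s.comp ≫ g)
      hdimn hν hmaxn (Scheme.IdealSheafData.vanishingIdeal Z).subschemeι hS2 hτ
    -- the concatenation
    refine ⟨s.append (s₁.append (CentreSeq.single D)), ?_, ?_, ?_⟩
    · rw [CentreSeq.allRegular_append_iff]; exact ⟨hreg, hreg₁⟩
    · rw [CentreSeq.centresInStratum_append_iff]; exact ⟨hstr, hstr₁⟩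
    intro z hz hη
    -- `H` does not increase along the round
    have hmono₁ : ∀ w : (s₁.append (CentreSeq.single D)).top,
        Scheme.hsFun (s₁.append (CentreSeq.single D)).top 3 w ≤
          Scheme.hsFun s.top 3 ((s₁.append (CentreSeq.single D)).comp.base w) :=
      CentreSeq.hsFun_comp_le_of_allRegular_of_centresInStratum _ hexcn hdimn hν hreg₁ hstr₁
    -- transport `z` to the last blow-up `Bl_D`
    obtain ⟨z₁, hz₁c, hz₁H, ⟨ez₁⟩⟩ := CentreSeq.transport_append s (s₁.append (CentreSeq.single D)) 3 z
    obtain ⟨z₂, hz₂c, hz₂H, ⟨ez₂⟩⟩ := CentreSeq.transport_append s₁ (CentreSeq.single D) 3 z₁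
    -- `z₂ : Bl_D`, its image `y₁'` in `s₁.top`, and `y₀` in `s.top`
    have hsingle : (CentreSeq.single D).comp.base z₂ = (blowup.π D).base z₂ := by
      show (𝟙 _ ≫ blowup.π D).base z₂ = _
      rw [Category.id_comp]
    set y₀ : s.top := s₁.comp.base ((blowup.π D).base z₂) with hy₀
    have hzimg : (s.append (s₁.append (CentreSeq.single D))).comp.base z = s.comp.base y₀ := by
      rw [hz₁c, hz₂c, hsingle]
    have hzν : Scheme.hsFun (s₁.append (CentreSeq.single D)).top 3 z₁ = ν := by
      rw [← hz₁H]; exact hz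
    have hy₀ν : y₀ ∈ Scheme.hsStratum s.top 3 ν := by
      rw [Scheme.mem_hsStratum_iff]
      have h1 : ν ≤ Scheme.hsFun s.top 3 y₀ := by
        have := hmono₁ z₁
        rw [hzν, hz₂c, hsingle] at this
        exact this
      exact le_antisymm (hupn _ ⟨y₀, rfl⟩ h1) h1
    have hη₀ : ringKrullDim (Y.presheaf.stalk (s.comp.base y₀)) = 1 := by rw [← hzimg]; exact hη
    -- the chain of the first `n` rounds for `y₀`
    obtain ⟨R, ⟨eR0⟩, ⟨eRn⟩, hsteps, hnreg⟩ := hpts y₀ hy₀ν hη₀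
    -- `y₀` is a codimension-one point of the stratum, hence a maximal point of `S`
    have hdim₀ : ringKrullDim (s.top.presheaf.stalk y₀) ≤ 1 :=
      (CentreSeq.ringKrullDim_stalk_le_comp s y₀).trans hη₀.le
    have hmax₀ : y₀ ∈ maxPoints (Scheme.hsStratum s.top 3 ν) :=
      mem_maxPoints_hsStratum_of_ringKrullDim_le_one hν hy₀ν hdim₀
    have hy₀Z : y₀ ∈ (Z : Set s.top) := subset_closure ⟨hy₀ν, hη₀⟩
    obtain ⟨s₀, hs₀⟩ : y₀ ∈ Set.range (Scheme.IdealSheafData.vanishingIdeal Z).subschemeι.base := by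
      rw [range_subschemeι_vanishingIdeal]; exact hy₀Z
    have hs₀max := maximalIdeal_mem_minimalPrimes_subscheme_of_mem_maxPoints Z hZν s₀
      (by rw [hs₀]; exact hmax₀)
    -- the round over `s₀`: the unique point `y*` of `s₁.top` over `y₀`
    obtain ⟨ys, hys, huniq, hiso, hysD, hDys⟩ := hround s₀ hs₀max
    rw [hs₀] at hys huniq
    have hy₁' : (blowup.π D).base z₂ = ys := huniq _ rfl
    haveI := hiso
    -- the new chain
    let R' : ℕ → CommRingCat.{u} := fun i =>
      if i ≤ n then R i else (s.append (s₁.append (CentreSeq.single D))).top.presheaf.stalk z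
    have hR'le : ∀ i, i ≤ n → R' i = R i := fun i hi => if_pos hi
    have hR'n1 : R' (n + 1) = (s.append (s₁.append (CentreSeq.single D))).top.presheaf.stalk z :=
      if_neg (by omega)
    refine ⟨R', ⟨?_⟩, ⟨?_⟩, fun i hi => ?_, fun i hi => ?_⟩
    · rw [hR'le 0 (Nat.zero_le n), hzimg]; exact eR0
    · rw [hR'n1]
    · -- the steps
      rcases Nat.lt_succ_iff_lt_or_eq.mp hi with hi' | rfl
      · obtain ⟨X, X', π, D', x, x', h1, h2, h3, ⟨e4⟩, ⟨e5⟩⟩ := hsteps i hi'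
        refine ⟨X, X', π, D', x, x', h1, h2, h3, ⟨?_⟩, ⟨?_⟩⟩
        · rw [hR'le i hi'.le]; exact e4
        · rw [hR'le (i + 1) hi']; exact e5
      · -- the new step: blow up `D` on `s₁.top` at `y*`
        refine ⟨s₁.top, blowup D, blowup.π D, D, ys, z₂, blowup.isBlowup D, hDys, hy₁', ⟨?_⟩, ⟨?_⟩⟩
        · -- `𝒪_{s₁.top, y*} ≅ 𝒪_{s.top, y₀} ≅ R n`
          rw [hR'le i le_rfl]
          have e1 : s.top.presheaf.stalk (s₁.comp.base ys) ≅ s₁.top.presheaf.stalk ys :=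
            asIso (s₁.comp.stalkMap ys)
          have e2 : s.top.presheaf.stalk (s₁.comp.base ys) ≅ s.top.presheaf.stalk y₀ :=
            eqToIso (by rw [hys])
          exact e1.symm ≪≫ e2 ≪≫ eRn.symm
        · rw [hR'n1]
          exact ez₂.symm ≪≫ ez₁.symm
    · -- non-regularity
      rcases Nat.lt_succ_iff_lt_or_eq.mp (Nat.lt_succ_iff.mpr hi) with hi' | rfl
      · rw [hR'le i (Nat.lt_succ_iff.mp hi')]; exact hnreg i (Nat.lt_succ_iff.mp hi')
      · rw [hR'n1]
        haveI : IsProper (s.append (s₁.append (CentreSeq.single D))).comp :=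
          CentreSeq.isProper_comp _
        haveI : IsLocallyNoetherian (s.append (s₁.append (CentreSeq.single D))).top :=
          LocallyOfFiniteType.isLocallyNoetherian
            ((s.append (s₁.append (CentreSeq.single D))).comp ≫ g)
        refine not_isRegularLocalRing_of_mem_hsStratum hν hz ?_
        have h1 := CentreSeq.ringKrullDim_stalk_le_comp (s.append (s₁.append (CentreSeq.single D))) z
        rw [hzimg, hη₀] at h1
        exact h1.trans (by exact_mod_cast (by norm_num : (1:ℕ) ≤ 3))

/-! ## FC-R1 -/

/-- **FC-R1 (card `fibral-confinement`, first rung; first round type of v3 `stub_confine3`): the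
maximal Hilbert–Samuel stratum of a reduced threefold is killed over its codimension-one points by a
blow-up sequence with REGULAR centres INSIDE the successive strata.** Let `Y` be reduced, locally of
finite type and quasi-compact over a field `k`, `dim Y ≤ 3`, and `ν ∈ Σ_Y(3)^max`, `ν ≠ Φ^{(3)}`.
Assume Cossart–Jannsen–Saito 2020 Thm. 1.2 with permissible centres (`hCJS`) and Krull 1930 / Kollár
2007 Thm. 1.101 (`hK`). Then there is `s : CentreSeq Y` with `s.AllRegular`, `s.CentresInStratum 3 ν`
(hence permissible, `H³`-monotone, centres over `Y(ν)`: p478970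
`CentreSeq.confinementClauses_of_allRegular_of_centresInStratum`) such that NO point of the
`ν`-stratum of `s.top` lies over a point `η` of `Y` with `dim 𝒪_{Y,η} = 1` — i.e. the surviving
stratum maps into the curve points and closed points of the threefold. Proof: the codimension-one
points of `Y(ν)` are finitely many maximal points of the closed stratum (`finite_maxPoints_of_isNoetherian`);
run `M + 1` rounds (`fcR1_iterate`), `M` the maximum of the Krull–Kollár bounds `m(𝒪_{Y,η})` (the
completion of `𝒪_{Y,η}` is reduced: `IsGRing.isReduced_adicCompletion`); a surviving point would carry
a chain of `M + 1` non-regular local quadratic transforms of some `𝒪_{Y,η}`, contradicting `hK`.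
[cite: CossartJannsenSaito2020, Thm. 1.2, Rem. 6.29 (1), Lemma 3.15 (1), Thm. 3.10 (1)]
[cite: Kollar2007, Thm. 1.101, 3.30.3] -/
theorem fcR1 (hCJS : CossartJannsenSaito2020SequencePermissible.{u})
    (hK : Kollar2007_thm_1_101_localChain.{u}) {k : Type u} [Field k] {Y : Scheme.{u}}
    (g : Y ⟶ Spec (.of k)) [LocallyOfFiniteType g] [QuasiCompact g] [IsReduced Y]
    (hdim : topologicalKrullDim Y ≤ ((3 : ℕ) : WithBot ℕ∞)) {ν : ℕ → ℕ} (hν : ν ≠ iterPSum 3 Phi)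
    (hmax : Maximal (· ∈ Scheme.hsValues Y 3) ν) :
    ∃ s : CentreSeq Y, s.AllRegular ∧ s.CentresInStratum 3 ν ∧
      ∀ y' : s.top, y' ∈ Scheme.hsStratum s.top 3 ν →
        ringKrullDim (Y.presheaf.stalk (s.comp.base y')) ≠ 1 := by
  haveI : IsLocallyNoetherian Y := LocallyOfFiniteType.isLocallyNoetherian g
  haveI : CompactSpace Y := QuasiCompact.compactSpace_of_compactSpace g
  haveI : IsNoetherian Y := {}
  have hexc : Scheme.IsExcellent Y :=
    Scheme.isExcellent_of_locallyOfFiniteType Stacks07QW_field_holds g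
  have hup : ∀ μ ∈ Scheme.hsValues Y 3, ν ≤ μ → μ ≤ ν := fun μ hμ hle => hmax.2 hμ hle
  -- the finitely many codimension-one points of the stratum and their Krull–Kollár bounds
  have hclosed : IsClosed (Scheme.hsStratum Y 3 ν) := isClosed_hsStratum_of_forall_le g hdim hup
  set T : Set Y := {η | η ∈ Scheme.hsStratum Y 3 ν ∧ ringKrullDim (Y.presheaf.stalk η) = 1} with hT
  have hTfin : T.Finite :=
    (finite_maxPoints_of_isNoetherian hclosed).subset fun η hη =>
      mem_maxPoints_hsStratum_of_ringKrullDim_le_one hν hη.1 hη.2.le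
  have hbound : ∀ η : Y, ringKrullDim (Y.presheaf.stalk η) = 1 → ∃ m : ℕ,
      ∀ R : ℕ → CommRingCat.{u}, Nonempty (R 0 ≅ CommRingCat.of (Y.presheaf.stalk η)) →
        (∀ i, i < m → ∃ (X X' : Scheme.{u}) (π : X' ⟶ X) (D : X.IdealSheafData) (x : X) (x' : X'),
          IsBlowup π D ∧ stalkIdeal D x = maximalIdeal (X.presheaf.stalk x) ∧ π.base x' = x ∧
            Nonempty (X.presheaf.stalk x ≅ R i) ∧ Nonempty (X'.presheaf.stalk x' ≅ R (i + 1))) →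
        ∃ i, i ≤ m ∧ IsRegularLocalRing (R i) := fun η hη =>
    hK (Y.presheaf.stalk η) hη
      ((Scheme.isGRing_stalk_of_isQuasiExcellent hexc.isQuasiExcellent η).isReduced_adicCompletion)
  classical
  let m : Y → ℕ := fun η => if hη : ringKrullDim (Y.presheaf.stalk η) = 1 then (hbound η hη).choose else 0
  have hm : ∀ η (hη : ringKrullDim (Y.presheaf.stalk η) = 1), ∀ R : ℕ → CommRingCat.{u},
      Nonempty (R 0 ≅ CommRingCat.of (Y.presheaf.stalk η)) →
        (∀ i, i < m η → ∃ (X X' : Scheme.{u}) (π : X' ⟶ X) (D : X.IdealSheafData) (x : X) (x' : X'),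
          IsBlowup π D ∧ stalkIdeal D x = maximalIdeal (X.presheaf.stalk x) ∧ π.base x' = x ∧
            Nonempty (X.presheaf.stalk x ≅ R i) ∧ Nonempty (X'.presheaf.stalk x' ≅ R (i + 1))) →
        ∃ i, i ≤ m η ∧ IsRegularLocalRing (R i) := by
    intro η hη
    have h := (hbound η hη).choose_spec
    simp only [m, dif_pos hη]
    exact h
  set M : ℕ := hTfin.toFinset.sup m with hM
  -- run `M + 1` rounds
  obtain ⟨s, hreg, hstr, hpts⟩ := fcR1_iterate hCJS hν (M + 1) g hdim hup
  refine ⟨s, hreg, hstr, fun y' hy' hη => ?_⟩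
  -- a surviving point carries too long a chain of non-regular quadratic transforms
  obtain ⟨R, ⟨eR0⟩, -, hsteps, hnreg⟩ := hpts y' hy' hη
  have hmonos : ∀ y : s.top, Scheme.hsFun s.top 3 y ≤ Scheme.hsFun Y 3 (s.comp.base y) :=
    CentreSeq.hsFun_comp_le_of_allRegular_of_centresInStratum s hexc hdim hν hreg hstr
  have hην : s.comp.base y' ∈ Scheme.hsStratum Y 3 ν := by
    rw [Scheme.mem_hsStratum_iff]
    have h1 : ν ≤ Scheme.hsFun Y 3 (s.comp.base y') :=
      (Scheme.mem_hsStratum_iff.mp hy') ▸ hmonos y'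
    exact le_antisymm (hup _ ⟨_, rfl⟩ h1) h1
  have hηT : s.comp.base y' ∈ hTfin.toFinset := hTfin.mem_toFinset.mpr ⟨hην, hη⟩
  have hmM : m (s.comp.base y') ≤ M := Finset.le_sup hηT
  obtain ⟨i, hi, hregi⟩ := hm (s.comp.base y') hη R ⟨eR0⟩
    (fun i hi => hsteps i (lt_of_lt_of_le hi (hmM.trans (Nat.le_succ M))))
  exact hnreg i (hi.trans (hmM.trans (Nat.le_succ M))) hregi

end Summit.ResolutionOfSingularities.ResolutionOfSingularities.Theorems.SigmaMaxModificationsCorridor3.Helpers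

end
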